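import Summits.QuantumFields.YangMills.Theorems.F4SubCurvatureDoorSubCurvatureKernelKernelSymmetries
import Literature.MathematicalPhysics.QuantumLattice.MinkowskiGeometry
import Mathlib
import HarnessLib

/-!
# Route `F4SubCurvatureDoor`, crux `SubCurvatureKernel` ⟨stmt-QuantumFields-23036⟩ — soft half, input (C) «continuity off 0»,
# part 5a: tools for the half-space step (time–space coordinates; bump averages of a tested kernel converge)

Helper file (`--supports stmt-QuantumFields-23036 --as helper`; free-hands seat `ym-line-frs-p2` g18).  Kernel-generic,
definition-free, 0 sorry, standard axioms.  No item is closed; no summit, no crux and no mass gap is proved by this file.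

WHAT.  `exists_timeSpace_equiv` / `exists_shiftedTimeSpace_equiv`: `(t, z⃗) ↦ (t, z⃗)` and `(t, z⃗) ↦ (−(δ + t), z⃗)` are
measure-preserving measurable equivalences `ℝ × ℝ³ ≃ ℝ⁴` (Mathlib's volume-preserving `EuclideanSpace ≃ (ι → ℝ)`, `Fin.insertNth`);
`integral_abs_sub_translate_le`: quantitative `L¹`-continuity of translation for compactly supported uniformly continuous functions;
★ `tendsto_bumpAverage`: for a bounded measurable `K'`, a continuous compactly supported `g` and bumps `bₙ ≥ 0`, `∫ bₙ = 1`,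
supported in balls of radii `εₙ → 0`, the bump averages `∫∫ bₙ(v) bₙ(u) (∫ g(ξ − θu + v) K'(ξ) dξ)` converge to `∫ g K'` — the
tested form of «mollified kernel → kernel» used with ✓`exists_mollifiedKernel` (C5).

HONEST LABEL: plumbing toward input (C) of the SOFT half of ⟨23036⟩; the SUB-CURVATURE clause is the crux, untouched; ⟨23036⟩ is an
open problem; the Yang–Mills mass gap is NOT proved; no summit is proved by a line.
-/

set_option autoImplicit false

noncomputable section

open scoped Topology ENNReal
open MeasureTheory Filter Set Metric Function
open Literature.MathematicalPhysics.QuantumLattice (timeReflection ofTimeSpace ofTimeSpace_apply_zero spaceC spaceC_ofTimeSpace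
  ofTimeSpace_apply_zero_spaceC)
open Summit.QuantumFields.YangMills.Theorems.NPointIsotropy.Negative (E4)

namespace Summit.QuantumFields.YangMills.Theorems.F4SubCurvatureDoorSubCurvatureKernelHalfSpaceTools

/-! ## §1 Time–space coordinates -/

/-- **`(t, z⃗) ↦ (t, z⃗) ∈ ℝ⁴` is a measure-preserving measurable equivalence** (for the volumes). [folklore] -/
theorem exists_timeSpace_equiv :
    ∃ e : (ℝ × EuclideanSpace ℝ (Fin 3)) ≃ᵐ E4, MeasurePreserving e ∧ ∀ p, e p = ofTimeSpace p.1 p.2 := by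
  let e₁ : E4 ≃ᵐ ℝ × EuclideanSpace ℝ (Fin 3) :=
    (MeasurableEquiv.toLp 2 (Fin 4 → ℝ)).symm.trans
      ((MeasurableEquiv.piFinSuccAbove (fun _ => ℝ) 0).trans
        (MeasurableEquiv.prodCongr (MeasurableEquiv.refl ℝ) (MeasurableEquiv.toLp 2 (Fin 3 → ℝ))))
  have he₁ : MeasurePreserving e₁ := by
    have h3 : MeasurePreserving
        (MeasurableEquiv.prodCongr (MeasurableEquiv.refl ℝ) (MeasurableEquiv.toLp 2 (Fin 3 → ℝ)))
        (volume.prod volume) (volume.prod volume) :=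
      (MeasurePreserving.id volume).prod (PiLp.volume_preserving_toLp (Fin 3))
    exact (h3.comp (volume_preserving_piFinSuccAbove (fun _ : Fin 4 => ℝ) 0)).comp (PiLp.volume_preserving_ofLp (Fin 4))
  refine ⟨e₁.symm, he₁.symm _, fun p => ?_⟩
  have h : e₁ (ofTimeSpace p.1 p.2) = p := by
    simp only [e₁, MeasurableEquiv.trans_apply, MeasurableEquiv.coe_toLp_symm, ofTimeSpace,
      MeasurableEquiv.piFinSuccAbove_apply]
    show (MeasurableEquiv.prodCongr (MeasurableEquiv.refl ℝ) (MeasurableEquiv.toLp 2 (Fin 3 → ℝ)))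
      ((Fin.insertNthEquiv (fun _ => ℝ) 0).symm (Fin.cons p.1 (WithLp.ofLp p.2))) = p
    rw [← Fin.insertNth_zero', show Fin.insertNth (α := fun _ : Fin 4 => ℝ) 0 p.1 (WithLp.ofLp p.2) =
      Fin.insertNthEquiv (fun _ => ℝ) 0 (p.1, WithLp.ofLp p.2) from rfl, Equiv.symm_apply_apply]
    rfl
  have h' := congrArg e₁.symm h
  rw [MeasurableEquiv.symm_apply_apply] at h'
  exact h'.symm

/-- **The reflected, shifted time–space map `(t, z⃗) ↦ (−(δ + t), z⃗)` is a measure-preserving measurable equivalence.** [folklore] -/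
theorem exists_shiftedTimeSpace_equiv (δ : ℝ) :
    ∃ W : (ℝ × EuclideanSpace ℝ (Fin 3)) ≃ᵐ E4, MeasurePreserving W ∧ ∀ p, W p = ofTimeSpace (-(δ + p.1)) p.2 := by
  obtain ⟨e, he, he_apply⟩ := exists_timeSpace_equiv
  set A : (ℝ × EuclideanSpace ℝ (Fin 3)) ≃ᵐ (ℝ × EuclideanSpace ℝ (Fin 3)) :=
    MeasurableEquiv.prodCongr ((MeasurableEquiv.addLeft δ).trans (MeasurableEquiv.neg ℝ)) (MeasurableEquiv.refl _) with hA
  have hA_apply : ∀ p : ℝ × EuclideanSpace ℝ (Fin 3), A p = (-(δ + p.1), p.2) := fun p => rfl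
  have hAm : MeasurePreserving A := by
    have h1 : MeasurePreserving ((MeasurableEquiv.addLeft δ).trans (MeasurableEquiv.neg ℝ)) volume volume :=
      (Measure.measurePreserving_neg (volume : Measure ℝ)).comp (measurePreserving_add_left volume δ)
    exact h1.prod (MeasurePreserving.id volume)
  refine ⟨A.trans e, he.comp hAm, fun p => ?_⟩
  rw [MeasurableEquiv.trans_apply, he_apply, hA_apply]

/-- **Quantitative `L¹`-continuity of translation for a compactly supported uniformly continuous function**: if
`|g x − g y| < η` whenever `dist x y < δ₁`, then `∫ |g(ξ + d) − g(ξ)| dξ ≤ η · vol B(0, R + 1)` for `‖d‖ < δ₁`, `‖d‖ ≤ 1`,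
`tsupport g ⊆ B(0, R)`. [folklore] -/
theorem integral_abs_sub_translate_le (g : E4 → ℝ) {R η δ₁ : ℝ} (hR : tsupport g ⊆ closedBall 0 R)
    (hη : 0 ≤ η) (hmod : ∀ x y, dist x y < δ₁ → dist (g x) (g y) < η) {d : E4} (hd : ‖d‖ < δ₁) (hd1 : ‖d‖ ≤ 1) :
    ∫ ξ, |g (ξ + d) - g ξ| ≤ η * (volume (closedBall (0 : E4) (R + 1))).toReal := by
  have hVfin : volume (closedBall (0 : E4) (R + 1)) < ⊤ := measure_closedBall_lt_top
  have hpt : ∀ ξ, |g (ξ + d) - g ξ| ≤ (closedBall (0 : E4) (R + 1)).indicator (fun _ => η) ξ := by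
    intro ξ
    by_cases hx : g (ξ + d) = 0 ∧ g ξ = 0
    · rw [hx.1, hx.2, sub_zero, abs_zero]; exact Set.indicator_nonneg (fun _ _ => hη) _
    · have hmem : ξ ∈ closedBall (0 : E4) (R + 1) := by
        rw [mem_closedBall, dist_zero_right]
        rcases not_and_or.1 hx with h | h
        · have := hR (subset_tsupport _ h); rw [mem_closedBall, dist_zero_right] at this
          have e : ‖ξ‖ ≤ ‖ξ + d‖ + ‖d‖ := by
            calc ‖ξ‖ = ‖(ξ + d) - d‖ := by rw [add_sub_cancel_right]
              _ ≤ ‖ξ + d‖ + ‖d‖ := norm_sub_le _ _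
          linarith
        · have := hR (subset_tsupport _ h); rw [mem_closedBall, dist_zero_right] at this; linarith
      rw [Set.indicator_of_mem hmem]
      have := hmod (ξ + d) ξ (by rw [dist_eq_norm, add_sub_cancel_left]; exact hd)
      rw [Real.dist_eq] at this
      exact this.le
  calc ∫ ξ, |g (ξ + d) - g ξ| ≤ ∫ ξ, (closedBall (0 : E4) (R + 1)).indicator (fun _ => η) ξ :=
        integral_mono_of_nonneg (Eventually.of_forall fun ξ => abs_nonneg _)
          ((integrable_indicator_iff measurableSet_closedBall).2 (integrableOn_const hVfin.ne)) (Eventually.of_forall hpt)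
    _ = η * (volume (closedBall (0 : E4) (R + 1))).toReal := by
        rw [integral_indicator_const _ measurableSet_closedBall, smul_eq_mul, Measure.real, mul_comm]

/-- `(t, z⃗) ↦ (−(δ + t), z⃗)` is continuous. [bookkeeping] -/
theorem continuous_shiftedTimeSpace (δ : ℝ) :
    Continuous fun p : ℝ × EuclideanSpace ℝ (Fin 3) => (ofTimeSpace (-(δ + p.1)) p.2 : E4) := by
  have h1 : Continuous fun p : ℝ × EuclideanSpace ℝ (Fin 3) => (Fin.cons (-(δ + p.1)) (WithLp.ofLp p.2) : Fin 4 → ℝ) := by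
    refine continuous_pi fun i => ?_
    refine Fin.cases ?_ (fun j => ?_) i
    · simp only [Fin.cons_zero]; fun_prop
    · simp only [Fin.cons_succ]
      exact (PiLp.continuous_apply 2 _ j).comp continuous_snd
  exact (PiLp.continuous_toLp 2 _).comp h1

/-! ## §2 ★ Bump averages of a tested kernel converge -/

/-- ★ **Bump averages of a tested bounded kernel converge**: `∫∫ bₙ(v) bₙ(u) (∫ g(ξ − θu + v) K'(ξ) dξ) → ∫ g K'` when the bumps
shrink (`εₙ → 0`). [folklore] -/
theorem tendsto_bumpAverage (K' : E4 → ℝ) (hK'm : Measurable K') {B : ℝ} (hB0 : 0 ≤ B) (hK'b : ∀ ξ, |K' ξ| ≤ B)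
    (g : E4 → ℝ) (hg : Continuous g) (hgc : HasCompactSupport g)
    (b : ℕ → E4 → ℝ) (hbcont : ∀ n, Continuous (b n)) (hbc : ∀ n, HasCompactSupport (b n)) (hb0 : ∀ n u, 0 ≤ b n u)
    (hb1 : ∀ n, ∫ u, b n u = 1) (ε : ℕ → ℝ) (hεpos : ∀ n, 0 < ε n) (hbsupp : ∀ n u, b n u ≠ 0 → ‖u‖ < ε n)
    (hεto : Tendsto ε atTop (𝓝 0)) :
    Tendsto (fun n => ∫ p : E4 × E4, (b n p.1 * b n p.2) * ∫ ξ, g (ξ - timeReflection 4 p.2 + p.1) * K' ξ) atTop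
      (𝓝 (∫ y, g y * K' y)) := by
  set θ := timeReflection 4 with hθ
  obtain ⟨Rg, hRg⟩ : ∃ R : ℝ, tsupport g ⊆ closedBall 0 R := hgc.isCompact.isBounded.subset_closedBall 0
  set Vg : ℝ := (volume (closedBall (0 : E4) (Rg + 1))).toReal with hVg
  have hVg0 : 0 ≤ Vg := ENNReal.toReal_nonneg
  have hguc : UniformContinuous g := hgc.uniformContinuous_of_continuous hg
  rw [Metric.tendsto_atTop]
  intro η hη
  set η' : ℝ := η / (B * Vg + 1) with hη'
  have hη'0 : 0 < η' := by positivity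
  obtain ⟨δ₁, hδ₁, hmod⟩ := Metric.uniformContinuous_iff.1 hguc η' hη'0
  obtain ⟨N, hN⟩ := (Metric.tendsto_atTop.1 hεto) (min (δ₁ / 2) (1 / 2)) (by positivity)
  refine ⟨N, fun n hn => ?_⟩
  have hεn : ε n < min (δ₁ / 2) (1 / 2) := by
    have := hN n hn; rw [Real.dist_eq, sub_zero, abs_of_pos (hεpos n)] at this; exact this
  -- the bump-averaged difference
  set Gf : E4 × E4 → ℝ := fun p => ∫ ξ, g (ξ - θ p.2 + p.1) * K' ξ with hGf
  have hGf_bd : ∀ p : E4 × E4, b n p.1 ≠ 0 → b n p.2 ≠ 0 → |Gf p - ∫ y, g y * K' y| ≤ B * (η' * Vg) := by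
    intro p h1 h2
    have hp1 : ‖p.1‖ < ε n := hbsupp n _ h1
    have hp2 : ‖p.2‖ < ε n := hbsupp n _ h2
    set d : E4 := -θ p.2 + p.1 with hd
    have hdn : ‖d‖ < 2 * ε n := by
      calc ‖d‖ ≤ ‖-θ p.2‖ + ‖p.1‖ := norm_add_le _ _
        _ = ‖p.2‖ + ‖p.1‖ := by rw [norm_neg, LinearIsometryEquiv.norm_map]
        _ < ε n + ε n := add_lt_add hp2 hp1
        _ = 2 * ε n := by ring
    have hdδ : ‖d‖ < δ₁ := by have := min_le_left (δ₁ / 2) (1 / 2); linarith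
    have hd1 : ‖d‖ ≤ 1 := by have := min_le_right (δ₁ / 2) (1 / 2); linarith
    have hgi : Integrable (fun ξ => g ξ * K' ξ) := by
      refine (hg.integrable_of_hasCompactSupport hgc).norm.const_mul B |>.mono' ?_ (Eventually.of_forall fun ξ => ?_)
      · exact (hg.measurable.mul hK'm).aestronglyMeasurable
      · rw [norm_mul, mul_comm]; exact mul_le_mul_of_nonneg_right (by rw [Real.norm_eq_abs]; exact hK'b ξ) (norm_nonneg _)
    have hgdi : Integrable (fun ξ => g (ξ + d) * K' ξ) := by
      have hgd : Continuous fun ξ => g (ξ + d) := hg.comp (continuous_id.add continuous_const)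
      have hgdc : HasCompactSupport fun ξ => g (ξ + d) := hgc.comp_homeomorph (Homeomorph.addRight d)
      refine (hgd.integrable_of_hasCompactSupport hgdc).norm.const_mul B |>.mono' ?_ (Eventually.of_forall fun ξ => ?_)
      · exact (hgd.measurable.mul hK'm).aestronglyMeasurable
      · rw [norm_mul, mul_comm]; exact mul_le_mul_of_nonneg_right (by rw [Real.norm_eq_abs]; exact hK'b ξ) (norm_nonneg _)
    have e1 : Gf p - ∫ y, g y * K' y = ∫ ξ, (g (ξ + d) - g ξ) * K' ξ := by
      simp only [hGf]
      rw [show (fun ξ => g (ξ - θ p.2 + p.1) * K' ξ) = fun ξ => g (ξ + d) * K' ξ from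
        funext fun ξ => by rw [hd]; congr 2; abel, ← integral_sub hgdi hgi]
      refine integral_congr_ae (Eventually.of_forall fun ξ => ?_); beta_reduce; ring
    rw [e1]
    calc |∫ ξ, (g (ξ + d) - g ξ) * K' ξ| ≤ ∫ ξ, |(g (ξ + d) - g ξ) * K' ξ| := abs_integral_le_integral_abs
      _ ≤ ∫ ξ, B * |g (ξ + d) - g ξ| := by
          refine integral_mono_of_nonneg (Eventually.of_forall fun ξ => abs_nonneg _) ?_
            (Eventually.of_forall fun ξ => ?_)
          · have hgI : Integrable g := hg.integrable_of_hasCompactSupport hgc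
            have hgdI : Integrable (fun ξ => g (ξ + d)) := hgI.comp_add_right d
            exact (hgdI.sub hgI).abs.const_mul B
          · beta_reduce; rw [abs_mul, mul_comm]; exact mul_le_mul_of_nonneg_right (hK'b ξ) (abs_nonneg _)
      _ = B * ∫ ξ, |g (ξ + d) - g ξ| := integral_const_mul _ _
      _ ≤ B * (η' * Vg) := mul_le_mul_of_nonneg_left
          (integral_abs_sub_translate_le g hRg hη'0.le hmod hdδ hd1) hB0
  -- sum against the bumps
  have hbi : Integrable (b n) := (hbcont n).integrable_of_hasCompactSupport (hbc n)
  have hbbi : Integrable (fun p : E4 × E4 => b n p.1 * b n p.2) := by have := hbi.mul_prod hbi; exact this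
  have hbb1 : ∫ p : E4 × E4, b n p.1 * b n p.2 = 1 := by
    rw [show (volume : Measure (E4 × E4)) = volume.prod volume from rfl, integral_prod_mul, hb1 n, mul_one]
  rw [Real.dist_eq]
  -- `Gf` is bounded, hence `b ⊗ b · Gf` integrable
  have hGf_b : ∀ p, |Gf p| ≤ B * ∫ ξ, |g ξ| := by
    intro p
    simp only [hGf]
    have hsh : ∫ ξ, |g (ξ - θ p.2 + p.1)| = ∫ ξ, |g ξ| := by
      have := integral_add_right_eq_self (μ := (volume : Measure E4)) (fun ξ => |g ξ|) (-θ p.2 + p.1)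
      rw [← this]; refine integral_congr_ae (Eventually.of_forall fun ξ => ?_); beta_reduce; congr 2; abel
    calc |∫ ξ, g (ξ - θ p.2 + p.1) * K' ξ| ≤ ∫ ξ, |g (ξ - θ p.2 + p.1) * K' ξ| := abs_integral_le_integral_abs
      _ ≤ ∫ ξ, B * |g (ξ - θ p.2 + p.1)| := by
          refine integral_mono_of_nonneg (Eventually.of_forall fun ξ => abs_nonneg _) ?_
            (Eventually.of_forall fun ξ => ?_)
          · have hgI : Integrable g := hg.integrable_of_hasCompactSupport hgc
            have := (hgI.comp_add_right (-θ p.2 + p.1)).abs.const_mul B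
            refine this.congr (Eventually.of_forall fun ξ => ?_); beta_reduce; congr 3; abel
          · beta_reduce; rw [abs_mul, mul_comm]; exact mul_le_mul_of_nonneg_right (hK'b ξ) (abs_nonneg _)
      _ = B * ∫ ξ, |g ξ| := by rw [integral_const_mul, hsh]
  have hGf_m : AEStronglyMeasurable Gf := by
    simp only [hGf]
    refine (MeasureTheory.StronglyMeasurable.integral_prod_right' (f := fun q : (E4 × E4) × E4 =>
      g (q.2 - θ q.1.2 + q.1.1) * K' q.2) ?_).aestronglyMeasurable
    refine Measurable.stronglyMeasurable ?_
    exact (hg.measurable.comp (by fun_prop)).mul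
      (hK'm.comp measurable_snd)
  have hbG : Integrable (fun p : E4 × E4 => (b n p.1 * b n p.2) * (Gf p - ∫ y, g y * K' y)) := by
    refine (hbbi.norm.mul_const (B * (∫ ξ, |g ξ|) + |∫ y, g y * K' y|)).mono'
      (hbbi.aestronglyMeasurable.mul (hGf_m.sub aestronglyMeasurable_const)) (Eventually.of_forall fun p => ?_)
    rw [norm_mul]
    refine mul_le_mul_of_nonneg_left ?_ (norm_nonneg _)
    rw [Real.norm_eq_abs]
    exact (abs_sub _ _).trans (add_le_add (hGf_b p) le_rfl)
  have e2 : (∫ p : E4 × E4, (b n p.1 * b n p.2) * Gf p) - ∫ y, g y * K' y =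
      ∫ p : E4 × E4, (b n p.1 * b n p.2) * (Gf p - ∫ y, g y * K' y) := by
    have h1 : ∫ p : E4 × E4, (b n p.1 * b n p.2) * (Gf p - ∫ y, g y * K' y) =
        (∫ p : E4 × E4, (b n p.1 * b n p.2) * Gf p) - ∫ p : E4 × E4, (b n p.1 * b n p.2) * ∫ y, g y * K' y := by
      rw [← integral_sub (hbG.add (hbbi.mul_const _) |>.congr (Eventually.of_forall fun p => by
        simp only [Pi.add_apply]; ring)) (hbbi.mul_const _)]
      refine integral_congr_ae (Eventually.of_forall fun p => ?_); simp only []; ring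
    rw [h1, integral_mul_const, hbb1, one_mul]
  rw [e2]
  calc |∫ p : E4 × E4, (b n p.1 * b n p.2) * (Gf p - ∫ y, g y * K' y)|
      ≤ ∫ p : E4 × E4, |(b n p.1 * b n p.2) * (Gf p - ∫ y, g y * K' y)| := abs_integral_le_integral_abs
    _ ≤ ∫ p : E4 × E4, (b n p.1 * b n p.2) * (B * (η' * Vg)) := by
        refine integral_mono_of_nonneg (Eventually.of_forall fun p => abs_nonneg _) (hbbi.mul_const _)
          (Eventually.of_forall fun p => ?_)
        beta_reduce
        rw [abs_mul, abs_of_nonneg (mul_nonneg (hb0 n _) (hb0 n _))]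
        by_cases h1 : b n p.1 = 0
        · simp [h1]
        by_cases h2 : b n p.2 = 0
        · simp [h2]
        exact mul_le_mul_of_nonneg_left (hGf_bd p h1 h2) (mul_nonneg (hb0 n _) (hb0 n _))
    _ = B * (η' * Vg) := by rw [integral_mul_const, hbb1, one_mul]
    _ < η := by
        rw [hη']
        have hBV : 0 ≤ B * Vg := mul_nonneg hB0 hVg0
        calc B * (η / (B * Vg + 1) * Vg) = (B * Vg) * (η / (B * Vg + 1)) := by ring
          _ < (B * Vg + 1) * (η / (B * Vg + 1)) := by gcongr; linarith
          _ = η := by field_simp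

end Summit.QuantumFields.YangMills.Theorems.F4SubCurvatureDoorSubCurvatureKernelHalfSpaceTools

end
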